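import Summits.QuantumAdvantage.AdviceFreeQNC0.SparseRead39
import Summits.QuantumAdvantage.AdviceFreeQNC0.GradedSeeds38ReductionS
import HarnessLib

/-!
# Tree port (qn-prover-3 g24), PART 2 of planner qa-qnc0-p1 g39's custody file `qa-qnc0-p1/exp39/SparseRead39.lean`
# (sha 32726d6b47a4b7b0), verbatim; part 1 = `SparseRead39.lean`.  See the module docstring of part 1 for the mathematics.
-/

noncomputable section

namespace Summit.QuantumAdvantage.AdviceFreeQNC0

open Finset Literature.Computability.QuantumComplexity Literature.Computability.MetaComplexity

namespace SparseRead39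

open scoped Classical

variable {N : ℕ}

/-- Indicator of the subcube `{x : x|_P = ξ|_P}`. -/
def pinInd (P : Finset (Fin N)) (ξ x : Fin N → Bool) : ℂ := if (∀ i ∈ P, x i = ξ i) then 1 else 0

/-- The pinned twisted win sum. -/
def pinSum (β : Fin N → ZMod 3) (P : Finset (Fin N)) (ξ : Fin N → Bool) (g : Fin N → (Fin N → Bool) → Bool) : ℂ :=
  ∑ x : Fin N → Bool, pinInd P ξ x * (phase β x * ind g x)

/-- **Conjecture `TwistBoundZConstPinned ρ`** (ROUND-38 §6.4.3; prover-sized via the register chain with deterministic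
steps at pinned letters): for constant outputs `b`, pins `x|_P = ξ|_P` and every `β`,
`‖Σ_{x : x|_P = ξ} e₃(β·x)·[OddZeros x ∧ Rel x b]‖ ≤ A·ρ^{#{i ∉ P : β_i ≠ 0}}·2^{N − #P}`. -/
def TwistBoundZConstPinned (ρ : ℝ) : Prop :=
  ∃ A : ℝ, ∀ (N : ℕ) (P : Finset (Fin N)) (ξ b : Fin N → Bool) (β : Fin N → ZMod 3),
    ‖pinSum β P ξ (fun k _ => b k)‖
      ≤ A * ρ ^ (univ.filter fun i : Fin N => i ∉ P ∧ β i ≠ 0).card * (2 : ℝ) ^ (N - P.card)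

/-- **`(R1)₀` = `R1Zero ρ`**: every strategy measurable w.r.t. the letters of an arbitrary set `W` obeys
`‖Σ_x e₃(β·x)·[OddZeros x ∧ Rel x (g x)]‖ ≤ A·ρ^{#{i ∉ W : β_i ≠ 0}}·2^N`. -/
def R1Zero (ρ : ℝ) : Prop :=
  ∃ A : ℝ, ∀ (N : ℕ) (W : Finset (Fin N)) (g : Fin N → (Fin N → Bool) → Bool),
    (∀ k (x x' : Fin N → Bool), (∀ i ∈ W, x i = x' i) → g k x = g k x') →
      ∀ β : Fin N → ZMod 3,
        ‖∑ x : Fin N → Bool, (ZMod.stdAddChar (∑ i : Fin N, if x i then β i else 0) : ℂ) *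
            (if (OddZeros x ∧ RingHLF.Rel x (fun k => g k x)) then (1 : ℂ) else 0)‖
          ≤ A * ρ ^ (univ.filter fun i : Fin N => i ∉ W ∧ β i ≠ 0).card * (2 : ℝ) ^ N

/-- Moving one letter from the junta set to the pins: `[x|_P = ξ]·[x_a = c] = [x|_{P ∪ {a}} = ξ[a ↦ c]]` (`a ∉ P`). -/
theorem pinInd_mul_indicator (P : Finset (Fin N)) (ξ x : Fin N → Bool) (a : Fin N) (haP : a ∉ P) (c : Bool) :
    pinInd P ξ x * (if x a = c then (1 : ℂ) else 0) = pinInd (insert a P) (Function.update ξ a c) x := by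
  unfold pinInd
  have hiff : (∀ i ∈ insert a P, x i = Function.update ξ a c i) ↔ (x a = c ∧ ∀ i ∈ P, x i = ξ i) := by
    constructor
    · intro h
      refine ⟨by simpa using h a (mem_insert_self a P), fun i hi => ?_⟩
      have hia : i ≠ a := fun e => haP (e ▸ hi)
      simpa [Function.update_of_ne hia] using h i (mem_insert_of_mem hi)
    · rintro ⟨ha, hP⟩ i hi
      rcases mem_insert.mp hi with rfl | hiP
      · simpa using ha
      · have hia : i ≠ a := fun e => haP (e ▸ hiP)
        rw [Function.update_of_ne hia]; exact hP i hiP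
  by_cases h1 : ∀ i ∈ P, x i = ξ i <;> by_cases h2 : x a = c
  · have h3 : ∀ i ∈ insert a P, x i = Function.update ξ a c i := hiff.mpr ⟨h2, h1⟩
    rw [if_pos h1, if_pos h2, if_pos h3, mul_one]
  · have h3 : ¬ ∀ i ∈ insert a P, x i = Function.update ξ a c i := fun h => h2 (hiff.mp h).1
    rw [if_neg h2, if_neg h3, mul_zero]
  · have h3 : ¬ ∀ i ∈ insert a P, x i = Function.update ξ a c i := fun h => h1 (hiff.mp h).2
    rw [if_neg h1, if_neg h3, zero_mul]
  · have h3 : ¬ ∀ i ∈ insert a P, x i = Function.update ξ a c i := fun h => h1 (hiff.mp h).2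
    rw [if_neg h1, if_neg h3, zero_mul]

/-- The pinned one-letter split: `pinSum β P ξ g = Σ_c pinSum β (P ∪ {a}) ξ[a ↦ c] g_c` (`a ∉ P`). -/
theorem pinSum_split (β : Fin N → ZMod 3) (P : Finset (Fin N)) (ξ : Fin N → Bool)
    (g : Fin N → (Fin N → Bool) → Bool) (a : Fin N) (haP : a ∉ P) :
    pinSum β P ξ g = ∑ c : Bool, pinSum β (insert a P) (Function.update ξ a c) (restrictAt g a c) := by
  unfold pinSum
  rw [Finset.sum_comm]
  refine Finset.sum_congr rfl fun x _ => ?_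
  rw [ind_split g a x, Finset.mul_sum, Finset.mul_sum]
  refine Finset.sum_congr rfl fun c _ => ?_
  rw [← pinInd_mul_indicator P ξ x a haP c]
  ring

/-- **Main lemma (lossless)**: under the pinned hypothesis with constant `A`, for disjoint `W`, `P`, every `g` determined
by `W`: `‖pinSum β P ξ g‖ ≤ A·ρ^{#{i ∉ W ∪ P : β_i ≠ 0}}·2^{N − #P}`. -/
theorem norm_pinSum_le_of_determined {ρ A : ℝ}
    (hA : ∀ (N : ℕ) (P : Finset (Fin N)) (ξ b : Fin N → Bool) (β : Fin N → ZMod 3),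
      ‖pinSum β P ξ (fun k _ => b k)‖
        ≤ A * ρ ^ (univ.filter fun i : Fin N => i ∉ P ∧ β i ≠ 0).card * (2 : ℝ) ^ (N - P.card))
    (W : Finset (Fin N)) :
    ∀ (P : Finset (Fin N)), Disjoint W P → ∀ (g : Fin N → (Fin N → Bool) → Bool),
      (∀ k (x x' : Fin N → Bool), (∀ i ∈ W, x i = x' i) → g k x = g k x') →
        ∀ (ξ : Fin N → Bool) (β : Fin N → ZMod 3),
          ‖pinSum β P ξ g‖
            ≤ A * ρ ^ (univ.filter fun i : Fin N => (i ∉ W ∧ i ∉ P) ∧ β i ≠ 0).card * (2 : ℝ) ^ (N - P.card) := by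
  induction W using Finset.induction_on with
  | empty =>
    intro P _ g hg ξ β
    have hconst : g = fun k _ => g k (fun _ => false) := by
      funext k x; exact hg k x _ (fun i hi => absurd hi (by simp))
    have e : (univ.filter fun i : Fin N => (i ∉ (∅ : Finset (Fin N)) ∧ i ∉ P) ∧ β i ≠ 0)
        = (univ.filter fun i : Fin N => i ∉ P ∧ β i ≠ 0) := by
      ext i; simp
    rw [hconst, e]
    exact hA N P ξ (fun k => g k fun _ => false) β
  | @insert a W haW ih =>
    intro P hdis g hg ξ β
    have haP : a ∉ P := Finset.disjoint_left.mp hdis (mem_insert_self a W)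
    have hdis' : Disjoint W (insert a P) := by
      rw [Finset.disjoint_insert_right]
      exact ⟨haW, (Finset.disjoint_insert_left.mp hdis).2⟩
    have e : ∀ c : Bool, (univ.filter fun i : Fin N => (i ∉ W ∧ i ∉ insert a P) ∧ β i ≠ 0)
        = (univ.filter fun i : Fin N => (i ∉ insert a W ∧ i ∉ P) ∧ β i ≠ 0) := by
      intro c; ext i; simp only [mem_filter, mem_univ, true_and, mem_insert, not_or]; tauto
    have hcardP : (insert a P).card = P.card + 1 := Finset.card_insert_of_notMem haP
    have hPN : P.card + 1 ≤ N := by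
      have := Finset.card_le_univ (insert a P); rw [hcardP, Fintype.card_fin] at this; exact this
    have hc : ∀ c : Bool, ‖pinSum β (insert a P) (Function.update ξ a c) (restrictAt g a c)‖
        ≤ A * ρ ^ (univ.filter fun i : Fin N => (i ∉ insert a W ∧ i ∉ P) ∧ β i ≠ 0).card * (2 : ℝ) ^ (N - (P.card + 1)) := by
      intro c
      have h := ih (insert a P) hdis' (restrictAt g a c) (restrictAt_determined hg c) (Function.update ξ a c) β
      rw [e c, hcardP] at h
      exact h
    calc ‖pinSum β P ξ g‖
        = ‖∑ c : Bool, pinSum β (insert a P) (Function.update ξ a c) (restrictAt g a c)‖ := by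
          rw [pinSum_split β P ξ g a haP]
      _ ≤ ∑ c : Bool, ‖pinSum β (insert a P) (Function.update ξ a c) (restrictAt g a c)‖ := norm_sum_le _ _
      _ ≤ ∑ _c : Bool, A * ρ ^ (univ.filter fun i : Fin N => (i ∉ insert a W ∧ i ∉ P) ∧ β i ≠ 0).card
            * (2 : ℝ) ^ (N - (P.card + 1)) := Finset.sum_le_sum fun c _ => hc c
      _ = A * ρ ^ (univ.filter fun i : Fin N => (i ∉ insert a W ∧ i ∉ P) ∧ β i ≠ 0).card * (2 : ℝ) ^ (N - P.card) := by
          rw [Fintype.sum_bool]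
          have hN : N - P.card = (N - (P.card + 1)) + 1 := by omega
          rw [hN, pow_succ]; ring

/-- **`r1Zero_of_pinned`**: the pinned constant-output twist bound implies `(R1)₀` with the SAME constant and NO loss. -/
theorem r1Zero_of_pinned {ρ : ℝ} (h : TwistBoundZConstPinned ρ) : R1Zero ρ := by
  obtain ⟨A, hA⟩ := h
  refine ⟨A, fun N W g hg β => ?_⟩
  have h1 := norm_pinSum_le_of_determined (N := N) hA W ∅ (Finset.disjoint_empty_right W) g hg (fun _ => false) β
  have hpin : ∀ x : Fin N → Bool, pinInd (∅ : Finset (Fin N)) (fun _ => false) x = 1 := by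
    intro x; unfold pinInd; simp
  have hrw : pinSum β ∅ (fun _ => false) g = ∑ x : Fin N → Bool,
      (ZMod.stdAddChar (∑ i : Fin N, if x i then β i else 0) : ℂ) *
        (if (OddZeros x ∧ RingHLF.Rel x (fun k => g k x)) then (1 : ℂ) else 0) := by
    unfold pinSum
    refine Finset.sum_congr rfl fun x _ => ?_
    rw [hpin x, one_mul]; rfl
  have e : (univ.filter fun i : Fin N => (i ∉ W ∧ i ∉ (∅ : Finset (Fin N))) ∧ β i ≠ 0)
      = (univ.filter fun i : Fin N => i ∉ W ∧ β i ≠ 0) := by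
    ext i; simp
  rw [hrw, e, Finset.card_empty, Nat.sub_zero] at h1
  exact h1

/-! ## v4 (g39, after A39-7): the NEXT rung — ONE outside letter per bell = AFFINE outputs on pinned subcubes, `(R1)₁`

With `TwistBoundZConstPinned` PROVED (`exp39/Pinned39.lean` v3), the next case of (R1) is `C = 0`: every output is determined by
`x|_W` and ONE further letter `i k` (scattered, arbitrary).  Pinning `W` losslessly as above leaves, on each subcube, outputs that are
AFFINE in one free letter: `g k x = b k ⊕ (c k ∧ x (i k))`.  So `(R1)` at `C = 0` for ALL `W` (no `3·#W ≤ N`, constant `A` instead of `N^A`)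
= `R1One ρ` below follows from the affine pinned bound `TwistBoundZAffinePinned ρ` with the SAME constant — `r1One_of_affinePinned`,
PROVED here.  The affine pinned bound itself is OPEN (the sign term `c_k·L_k·x_{i k}` couples letter `i k` to the liveness at bell
`k`; B-39.1 says the liveness must be used; numerically window-dominated, ROUND-38 §6.4.1).
STATUS (qn-prover-3 g25): `R1One (39/40)` is PROVED DIRECTLY — `SparseRead39.r1One`, file `R1OneFibre39.lean` (kernel-line fibre method:
`T k = insert (i k) W`, transversal `A = supp β ∖ W`; far reads included, constant `A = 2`), so `TwistBoundZAffinePinned` is no longer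
needed by the line (it stays open: as a worst case over pins it embeds quadratic-𝔽₂-phase sums, PROVER3-MEMO-gen25 §2). -/

/-- Affine one-letter outputs: bell `k` outputs `b k ⊕ (c k ∧ x (i k))`. -/
def affOut (b c : Fin N → Bool) (i : Fin N → Fin N) (k : Fin N) (x : Fin N → Bool) : Bool :=
  xor (b k) (c k && x (i k))

/-- **Conjecture `TwistBoundZAffinePinned ρ`** (the prover target after A39-7): for affine one-letter outputs, pins `x|_P = ξ|_P`
and every `β`, `‖Σ_{x : x|_P = ξ} e₃(β·x)·[OddZeros x ∧ Rel x (b ⊕ c·x_{i(·)})]‖ ≤ A·ρ^{#{j ∉ P : β_j ≠ 0}}·2^{N − #P}`.  OPEN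
(and superseded: its consequence `R1One` is proved directly in `R1OneFibre39.lean`). -/
def TwistBoundZAffinePinned (ρ : ℝ) : Prop :=
  ∃ A : ℝ, ∀ (N : ℕ) (P : Finset (Fin N)) (ξ b c : Fin N → Bool) (i : Fin N → Fin N) (β : Fin N → ZMod 3),
    ‖pinSum β P ξ (affOut b c i)‖
      ≤ A * ρ ^ (univ.filter fun j : Fin N => j ∉ P ∧ β j ≠ 0).card * (2 : ℝ) ^ (N - P.card)

/-- **`(R1)₁` = `R1One ρ`**: every strategy each of whose outputs is determined by `x|_W` and ONE further letter `x_{i k}`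
(`W`, `i` arbitrary) obeys `‖Σ_x e₃(β·x)·[OddZeros x ∧ Rel x (g x)]‖ ≤ A·ρ^{#{j ∉ W : β_j ≠ 0}}·2^N` — (R1) `TwistedJuntaBoundX3S`
at `C = 0` for these strategies, without `3·#W ≤ N` and with a constant in place of `N^A`.  PROVED for `ρ = 39/40`, `A = 2`:
`SparseRead39.r1One` (`R1OneFibre39.lean`, qn-prover-3 g25). -/
def R1One (ρ : ℝ) : Prop :=
  ∃ A : ℝ, ∀ (N : ℕ) (W : Finset (Fin N)) (i : Fin N → Fin N) (g : Fin N → (Fin N → Bool) → Bool),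
    (∀ k (x x' : Fin N → Bool), (∀ j ∈ W, x j = x' j) → x (i k) = x' (i k) → g k x = g k x') →
      ∀ β : Fin N → ZMod 3,
        ‖∑ x : Fin N → Bool, (ZMod.stdAddChar (∑ j : Fin N, if x j then β j else 0) : ℂ) *
            (if (OddZeros x ∧ RingHLF.Rel x (fun k => g k x)) then (1 : ℂ) else 0)‖
          ≤ A * ρ ^ (univ.filter fun j : Fin N => j ∉ W ∧ β j ≠ 0).card * (2 : ℝ) ^ N

/-- Restriction preserves the one-letter class. -/
theorem restrictAt_oneLetter {g : Fin N → (Fin N → Bool) → Bool} {a : Fin N} {R : Finset (Fin N)} {i : Fin N → Fin N}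
    (hg : ∀ k (x x' : Fin N → Bool), (∀ j ∈ insert a R, x j = x' j) → x (i k) = x' (i k) → g k x = g k x') (c : Bool) :
    ∀ k (x x' : Fin N → Bool), (∀ j ∈ R, x j = x' j) → x (i k) = x' (i k) →
      restrictAt g a c k x = restrictAt g a c k x' := by
  intro k x x' hxx' hik
  refine hg k _ _ (fun j hj => ?_) ?_
  · rcases Finset.mem_insert.mp hj with rfl | hjR
    · simp
    · by_cases hja : j = a
      · subst hja; simp
      · rw [Function.update_of_ne hja, Function.update_of_ne hja]; exact hxx' j hjR
  · by_cases hia : i k = a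
    · rw [hia]; simp
    · rw [Function.update_of_ne hia, Function.update_of_ne hia]; exact hik

/-- A one-letter strategy with `W = ∅` is affine: `g k x = b k ⊕ (c k ∧ x (i k))` with `b k = g k 0`, `c k = g k 0 ⊕ g k 1`. -/
theorem affine_of_oneLetter_empty {g : Fin N → (Fin N → Bool) → Bool} {i : Fin N → Fin N}
    (hg : ∀ k (x x' : Fin N → Bool), (∀ j ∈ (∅ : Finset (Fin N)), x j = x' j) → x (i k) = x' (i k) → g k x = g k x') :
    g = affOut (fun k => g k (fun _ => false)) (fun k => xor (g k (fun _ => false)) (g k (fun _ => true))) i := by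
  funext k x
  show g k x = xor (g k (fun _ => false)) ((xor (g k (fun _ => false)) (g k (fun _ => true))) && x (i k))
  cases hx : x (i k)
  · have e : g k x = g k (fun _ => false) := hg k x _ (fun j hj => absurd hj (by simp)) (by rw [hx])
    rw [e]
    cases g k (fun _ => false) <;> cases g k (fun _ => true) <;> rfl
  · have e : g k x = g k (fun _ => true) := hg k x _ (fun j hj => absurd hj (by simp)) (by rw [hx])
    rw [e]
    cases g k (fun _ => false) <;> cases g k (fun _ => true) <;> rfl

/-- **Main lemma (lossless, one outside letter)**: under the affine pinned hypothesis with constant `A`, for disjoint `W`, `P`,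
every one-letter strategy over `W`: `‖pinSum β P ξ g‖ ≤ A·ρ^{#{j ∉ W ∪ P : β_j ≠ 0}}·2^{N − #P}`. -/
theorem norm_pinSum_le_of_oneLetter {ρ A : ℝ}
    (hA : ∀ (N : ℕ) (P : Finset (Fin N)) (ξ b c : Fin N → Bool) (i : Fin N → Fin N) (β : Fin N → ZMod 3),
      ‖pinSum β P ξ (affOut b c i)‖
        ≤ A * ρ ^ (univ.filter fun j : Fin N => j ∉ P ∧ β j ≠ 0).card * (2 : ℝ) ^ (N - P.card))
    (i : Fin N → Fin N) (W : Finset (Fin N)) :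
    ∀ (P : Finset (Fin N)), Disjoint W P → ∀ (g : Fin N → (Fin N → Bool) → Bool),
      (∀ k (x x' : Fin N → Bool), (∀ j ∈ W, x j = x' j) → x (i k) = x' (i k) → g k x = g k x') →
        ∀ (ξ : Fin N → Bool) (β : Fin N → ZMod 3),
          ‖pinSum β P ξ g‖
            ≤ A * ρ ^ (univ.filter fun j : Fin N => (j ∉ W ∧ j ∉ P) ∧ β j ≠ 0).card * (2 : ℝ) ^ (N - P.card) := by
  induction W using Finset.induction_on with
  | empty =>
    intro P _ g hg ξ β
    have e : (univ.filter fun j : Fin N => (j ∉ (∅ : Finset (Fin N)) ∧ j ∉ P) ∧ β j ≠ 0)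
        = (univ.filter fun j : Fin N => j ∉ P ∧ β j ≠ 0) := by
      ext j; simp
    rw [affine_of_oneLetter_empty hg, e]
    exact hA N P ξ _ _ i β
  | @insert a W haW ih =>
    intro P hdis g hg ξ β
    have haP : a ∉ P := Finset.disjoint_left.mp hdis (mem_insert_self a W)
    have hdis' : Disjoint W (insert a P) := by
      rw [Finset.disjoint_insert_right]
      exact ⟨haW, (Finset.disjoint_insert_left.mp hdis).2⟩
    have e : ∀ c : Bool, (univ.filter fun j : Fin N => (j ∉ W ∧ j ∉ insert a P) ∧ β j ≠ 0)
        = (univ.filter fun j : Fin N => (j ∉ insert a W ∧ j ∉ P) ∧ β j ≠ 0) := by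
      intro c; ext j; simp only [mem_filter, mem_univ, true_and, mem_insert, not_or]; tauto
    have hcardP : (insert a P).card = P.card + 1 := Finset.card_insert_of_notMem haP
    have hPN : P.card + 1 ≤ N := by
      have := Finset.card_le_univ (insert a P); rw [hcardP, Fintype.card_fin] at this; exact this
    have hc : ∀ c : Bool, ‖pinSum β (insert a P) (Function.update ξ a c) (restrictAt g a c)‖
        ≤ A * ρ ^ (univ.filter fun j : Fin N => (j ∉ insert a W ∧ j ∉ P) ∧ β j ≠ 0).card * (2 : ℝ) ^ (N - (P.card + 1)) := by
      intro c
      have h := ih (insert a P) hdis' (restrictAt g a c) (restrictAt_oneLetter hg c) (Function.update ξ a c) β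
      rw [e c, hcardP] at h
      exact h
    calc ‖pinSum β P ξ g‖
        = ‖∑ c : Bool, pinSum β (insert a P) (Function.update ξ a c) (restrictAt g a c)‖ := by
          rw [pinSum_split β P ξ g a haP]
      _ ≤ ∑ c : Bool, ‖pinSum β (insert a P) (Function.update ξ a c) (restrictAt g a c)‖ := norm_sum_le _ _
      _ ≤ ∑ _c : Bool, A * ρ ^ (univ.filter fun j : Fin N => (j ∉ insert a W ∧ j ∉ P) ∧ β j ≠ 0).card
            * (2 : ℝ) ^ (N - (P.card + 1)) := Finset.sum_le_sum fun c _ => hc c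
      _ = A * ρ ^ (univ.filter fun j : Fin N => (j ∉ insert a W ∧ j ∉ P) ∧ β j ≠ 0).card * (2 : ℝ) ^ (N - P.card) := by
          rw [Fintype.sum_bool]
          have hN : N - P.card = (N - (P.card + 1)) + 1 := by omega
          rw [hN, pow_succ]; ring

/-- **`r1One_of_affinePinned`**: the affine pinned twist bound implies `(R1)₁` with the SAME constant and NO loss. -/
theorem r1One_of_affinePinned {ρ : ℝ} (h : TwistBoundZAffinePinned ρ) : R1One ρ := by
  obtain ⟨A, hA⟩ := h
  refine ⟨A, fun N W i g hg β => ?_⟩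
  have h1 := norm_pinSum_le_of_oneLetter (N := N) hA i W ∅ (Finset.disjoint_empty_right W) g hg (fun _ => false) β
  have hpin : ∀ x : Fin N → Bool, pinInd (∅ : Finset (Fin N)) (fun _ => false) x = 1 := by
    intro x; unfold pinInd; simp
  have hrw : pinSum β ∅ (fun _ => false) g = ∑ x : Fin N → Bool,
      (ZMod.stdAddChar (∑ j : Fin N, if x j then β j else 0) : ℂ) *
        (if (OddZeros x ∧ RingHLF.Rel x (fun k => g k x)) then (1 : ℂ) else 0) := by
    unfold pinSum
    refine Finset.sum_congr rfl fun x _ => ?_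
    rw [hpin x, one_mul]; rfl
  have e : (univ.filter fun j : Fin N => (j ∉ W ∧ j ∉ (∅ : Finset (Fin N))) ∧ β j ≠ 0)
      = (univ.filter fun j : Fin N => j ∉ W ∧ β j ≠ 0) := by
    ext j; simp
  rw [hrw, e, Finset.card_empty, Nat.sub_zero] at h1
  exact h1

/-- Sanity: the affine bound contains the constant one (`c ≡ false`). -/
theorem constPinned_of_affinePinned {ρ : ℝ} (h : TwistBoundZAffinePinned ρ) : TwistBoundZConstPinned ρ := by
  obtain ⟨A, hA⟩ := h
  refine ⟨A, fun N P ξ b β => ?_⟩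
  have e : (fun (k : Fin N) (_ : Fin N → Bool) => b k) = affOut b (fun _ => false) id := by
    funext k x; unfold affOut; simp
  rw [e]
  exact hA N P ξ b (fun _ => false) id β

end SparseRead39

end Summit.QuantumAdvantage.AdviceFreeQNC0
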